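import Literature.Barriers.AtomisticToContinuum.AnticontinuumLocalizationGeometry2
import Mathlib.Analysis.SpecialFunctions.SmoothTransition
import HarnessLib

/-!
# De Roeck–Huveneers 2015, §4.1–4.2 for the rotor chain: clusters, smooth blocks and the cut-offs `θ_x`

`Literature/Barriers/AtomisticToContinuum/` — continuation of `…Geometry2.lean`. The smooth version
of the construction of §4.2 of W. De Roeck, F. Huveneers, CPAM 68 (2015), arXiv:1305.5127 — the
printed `θ_x` is a convolution of `𝟙_{R(x)^c}` with a bump; here the blocks themselves are smoothed
(which keeps every property used in §5), and the printed connectivity of clusters is replaced by the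
explicit support bound it implies (members of a cluster of size `p` around `x` live in
`B(x, 4r + 2r(p-1))`), PROVED:

* clusters (`IsClusterAround`, `clusters`, singletons, one-step extension `isClusterAround_insert`);
  supports of the span (`apply_eq_zero_of_mem_modeSpan`) and locality of the projections
  (`proj_wvec_eq_of_eqOn`);
* the smooth step `stepDown a b` (`= 1` on `(-∞, a]`, `= 0` on `[b, ∞)`, in `[0,1]`), the smooth block
  indicator `psiQ` (`psiQ = 1 ↔` core block, `0 < psiQ ↔` enlarged block) and
  **`thetaX x δ ω = ∏_{Q ∈ clusters} (1 - psiQ Q δ ω)`**, with `0 ≤ θ ≤ 1`;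
* **the first item of Prop. 2** (`nonres_of_thetaX_pos`), the near-resonance behind `θ_x < 1` used in
  the proof of Lemma 4 (§5.5) (`nearRes_of_thetaX_lt_one`) and the locality of `θ_x` (§5.3)
  (`thetaW_eq_of_eqOn`: `θ_x` depends on `ω` only in `B(x, 4r + 2r(n₂-1))`).
-/

noncomputable section

open Function Set Finset Filter Metric WithLp Module
open scoped BigOperators Topology InnerProductSpace ContDiff

namespace Literature.Barriers.AtomisticToContinuum.HeatConduction.RotorChain

open Literature.MathematicalPhysics.KineticTheory.HeatConduction

variable {m : ℕ}

/-! ### Clusters -/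

/-- Two modes touch: their supports intersect. [cite: DeRoeckHuveneers2015, §4.1 ("`supp(k_{i_s}) ∩ supp(k_{i_{s+1}}) ≠ ∅`")] -/
def Touch (k k' : Fin m → ℤ) : Prop := ∃ y, k y ≠ 0 ∧ k' y ≠ 0

/-- Non-orthogonal modes touch. [folklore] -/
theorem touch_of_inner_ne_zero {k k' : Fin m → ℤ} (h : ⟪kvec k, kvec k'⟫_ℝ ≠ 0) : Touch k k' := by
  by_contra hc
  apply h
  rw [kvec, kvec, EuclideanSpace.inner_toLp_toLp]
  refine Finset.sum_eq_zero fun y _ => ?_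
  simp only [Touch, not_exists, not_and, not_not] at hc
  by_cases hy : k y = 0
  · simp [modeVec, hy]
  · simp [modeVec, hc y hy]

/-- The cluster radius for size `p`: `4r + 2r(p-1)` (what connectivity and "`supp(k_j) ⊂ B(x,4r)` for some `j`" give). [cite: DeRoeckHuveneers2015, §4.1 (definition of a cluster around `x`)] -/
def clusterRad (r p : ℕ) : ℕ := 4 * r + 2 * r * (p - 1)

/-- The cluster radius grows by `2r` per member. [folklore] -/
theorem clusterRad_succ (r : ℕ) {p : ℕ} (hp : 1 ≤ p) : clusterRad r p + 2 * r = clusterRad r (p + 1) := by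
  unfold clusterRad
  rw [Nat.add_sub_cancel, add_assoc, ← Nat.mul_succ, Nat.succ_eq_add_one, Nat.sub_add_cancel hp]

/-- Monotonicity of the cluster radius. [folklore] -/
theorem clusterRad_mono (r : ℕ) {p p' : ℕ} (h : p ≤ p') : clusterRad r p ≤ clusterRad r p' := by
  unfold clusterRad; exact Nat.add_le_add_left (Nat.mul_le_mul_left _ (by omega)) _

/-- **Clusters around `x`**: nonempty, members in `K_r`, linearly independent, all members supported
in `B(x, 4r + 2r(|Q|-1))` (the support bound that connectivity + "one member in `B(x,4r)`" give).
[cite: DeRoeckHuveneers2015, §4.1 (definition of a cluster around `x`)] -/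
def IsClusterAround (r : ℕ) (x : Fin m) (Q : Finset (Fin m → ℤ)) : Prop :=
  Q.Nonempty ∧ (∀ k ∈ Q, IsKMode r k) ∧ IsLI Q ∧ ∀ k ∈ Q, ModeNear x (clusterRad r Q.card) k

open scoped Classical in
/-- The clusters around `x` with at most `n₂` members. [cite: DeRoeckHuveneers2015, §4.2 ("with `p ≤ n₂`")] -/
def clusters (r n₂ : ℕ) (x : Fin m) : Finset (Finset (Fin m → ℤ)) :=
  (BModes m r).powerset.filter fun Q => IsClusterAround r x Q ∧ Q.card ≤ n₂

/-- Membership in `clusters`. [folklore] -/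
theorem mem_clusters {r n₂ : ℕ} {x : Fin m} {Q : Finset (Fin m → ℤ)} :
    Q ∈ clusters r n₂ x ↔ IsClusterAround r x Q ∧ Q.card ≤ n₂ := by
  classical
  simp only [clusters, Finset.mem_filter, Finset.mem_powerset, and_iff_right_iff_imp]
  exact fun h k hk => mem_BModes_of_isKMode (h.1.2.1 k hk)

/-- Clusters consist of bounded modes. [folklore] -/
theorem IsClusterAround.subset_BModes {r : ℕ} {x : Fin m} {Q : Finset (Fin m → ℤ)} (h : IsClusterAround r x Q) : Q ⊆ BModes m r :=
  fun k hk => mem_BModes_of_isKMode (h.2.1 k hk)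

/-- A singleton of `K_r(B(x,4r))` is a cluster around `x`. [cite: DeRoeckHuveneers2015, §4.3 proof of Prop. 2 ("`{k}` alone is a cluster around `x`")] -/
theorem isClusterAround_singleton {r : ℕ} {x : Fin m} {k : Fin m → ℤ} (hk : IsKMode r k) (hn : ModeNear x (4 * r) k) :
    IsClusterAround r x {k} := by
  refine ⟨Finset.singleton_nonempty k, fun k' hk' => by rw [Finset.mem_singleton.1 hk']; exact hk, isLI_singleton hk.1, ?_⟩
  intro k' hk'
  rw [Finset.mem_singleton.1 hk', Finset.card_singleton]
  simpa [clusterRad] using hn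

/-- **One-step extension**: adding to a cluster of size `p` a mode `k ∈ K_r`, `k ∉ span Q`, not orthogonal
to `span Q`, gives a cluster (of size `p + 1`, radius `4r + 2rp`). [cite: DeRoeckHuveneers2015, §4.3 proof of Prop. 2, case 3 ("otherwise `{k_1, …, k_p, k}` would form a cluster around `x` containing `p+1 ≤ n₂` independent vectors")] -/
theorem isClusterAround_insert {r : ℕ} {x : Fin m} {Q : Finset (Fin m → ℤ)} (hQ : IsClusterAround r x Q) {k : Fin m → ℤ}
    (hk : IsKMode r k) (hkV : kvec k ∉ modeSpan Q) (hno : kvec k ∉ (modeSpan Q)ᗮ) : IsClusterAround r x (insert k Q) := by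
  obtain ⟨hne, hK, hli, hsupp⟩ := hQ
  have hkQ : k ∉ Q := fun h => hkV (kvec_mem_modeSpan h)
  have hcard : (insert k Q).card = Q.card + 1 := Finset.card_insert_of_notMem hkQ
  -- `k` touches some member
  obtain ⟨k₀, hk₀, ht⟩ : ∃ k₀ ∈ Q, Touch k k₀ := by
    by_contra hc
    push Not at hc
    apply hno
    rw [modeSpan, Submodule.mem_orthogonal']
    intro v hv
    refine Submodule.span_induction (p := fun v _ => ⟪kvec k, v⟫_ℝ = 0) ?_ ?_ ?_ ?_ hv
    · rintro _ ⟨k', hk', rfl⟩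
      by_contra h
      exact hc k' hk' (touch_of_inner_ne_zero h)
    · exact inner_zero_right _
    · intro a b _ _ ha hb; rw [inner_add_right, ha, hb, add_zero]
    · intro c a _ ha; rw [inner_smul_right, ha, mul_zero]
  refine ⟨Finset.insert_nonempty k Q, ?_, hli.insert hkV, ?_⟩
  · intro k' hk'
    rcases Finset.mem_insert.1 hk' with rfl | h
    · exact hk
    · exact hK k' h
  · intro k' hk'
    rw [hcard]
    have hp1 : 1 ≤ Q.card := Finset.card_pos.2 hne
    rcases Finset.mem_insert.1 hk' with rfl | h
    · have h1 := modeNear_of_touch (hsupp k₀ hk₀) hk (by obtain ⟨y, h1, h2⟩ := ht; exact ⟨y, h2, h1⟩)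
      rw [← clusterRad_succ r hp1]
      exact h1
    · exact fun y hy => hsupp k' h y (lt_of_le_of_lt (clusterRad_mono r (Nat.le_succ _)) hy)

where
  /-- touching `K_r`-modes have nearby supports -/
  modeNear_of_touch {r R : ℕ} {x : Fin m} {k k' : Fin m → ℤ} (hk : ModeNear x R k) (hk' : IsKMode r k') (ht : Touch k k') :
      ModeNear x (R + 2 * r) k' := by
    obtain ⟨y, hy, hy'⟩ := ht
    obtain ⟨c, hc⟩ := hk'.2.2
    have h1 : Nat.dist x.val y.val ≤ R := by by_contra h; exact hy (hk y (not_le.1 h))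
    have h2 : Nat.dist c.val y.val ≤ r := by by_contra h; exact hy' (hc y (not_le.1 h))
    intro z hz
    apply hc
    have t1 := Nat.dist.triangle_inequality x.val c.val z.val
    have t2 := Nat.dist.triangle_inequality x.val y.val c.val
    rw [Nat.dist_comm y.val c.val] at t2
    omega

/-! ### Supports of the span and locality of the projections -/

/-- A vector of `span Q` vanishes at every coordinate where all members of `Q` vanish. [folklore] -/
theorem apply_eq_zero_of_mem_modeSpan {Q : Finset (Fin m → ℤ)} {v : Euc m} (hv : v ∈ modeSpan Q) {y : Fin m}
    (hy : ∀ k ∈ Q, k y = 0) : v y = 0 := by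
  refine Submodule.span_induction (p := fun v _ => v y = 0) ?_ ?_ ?_ ?_ hv
  · rintro _ ⟨k, hk, rfl⟩; simp [hy k hk]
  · rfl
  · intro a b _ _ ha hb; simp [ha, hb]
  · intro c a _ ha; simp [ha]

/-- The coordinates supporting `Q`. [folklore] -/
def clusterSupp (Q : Finset (Fin m → ℤ)) : Set (Fin m) := {y | ∃ k ∈ Q, k y ≠ 0}

/-- **Locality of the projections**: momenta agreeing on the support of `Q` have the same resonant part.
[cite: DeRoeckHuveneers2015, §5.3 ("the functions `ϑ_{a,x}` … only depend on variables indexed by `z` with `z ≥ a - (n₃ + 4r + n₂ r)`")] -/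
theorem proj_wvec_eq_of_eqOn {Q : Finset (Fin m → ℤ)} {w w' : Fin m → ℝ} (h : ∀ y ∈ clusterSupp Q, w y = w' y) :
    proj Q (wvec w) = proj Q (wvec w') := by
  have horth : wvec w - wvec w' ∈ (modeSpan Q)ᗮ := by
    rw [Submodule.mem_orthogonal]
    intro v hv
    rw [show (wvec w - wvec w' : Euc m) = toLp 2 (w - w') from rfl]
    have : ∀ y, v y * (w - w') y = 0 := by
      intro y
      by_cases hy : ∀ k ∈ Q, k y = 0
      · rw [apply_eq_zero_of_mem_modeSpan hv hy, zero_mul]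
      · push Not at hy
        obtain ⟨k, hk, hky⟩ := hy
        rw [Pi.sub_apply, h y ⟨k, hk, hky⟩, sub_self, mul_zero]
    rw [show v = toLp 2 (ofLp v) from rfl, EuclideanSpace.inner_toLp_toLp]
    simpa [dotProduct, mul_comm] using Finset.sum_eq_zero fun y (_ : y ∈ Finset.univ) => this y
  have h0 : proj Q (wvec w - wvec w') = 0 := (modeSpan Q).starProjection_apply_eq_zero_iff.2 horth
  rwa [map_sub, sub_eq_zero] at h0

/-- Members of `K_r ∩ span Q` are supported inside the support of `Q`. [folklore] -/
theorem clusterSupp_subset_of_le {Q Q' : Finset (Fin m → ℤ)} (hle : modeSpan Q' ≤ modeSpan Q) : clusterSupp Q' ⊆ clusterSupp Q := by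
  rintro y ⟨k', hk', hy⟩
  by_contra hc
  simp only [clusterSupp, Set.mem_setOf_eq, not_exists, not_and, not_not] at hc
  apply hy
  have := apply_eq_zero_of_mem_modeSpan (hle (kvec_mem_modeSpan hk')) hc
  rw [kvec_apply] at this
  exact Int.cast_eq_zero.1 this

/-- The support of a cluster of size `≤ n₂` around `x` lies in `B(x, 4r + 2r(n₂-1))`. [cite: DeRoeckHuveneers2015, §5.3 ("the functions `ϑ_{a,x}` … only depend on variables indexed by `z` with `z ≥ a - (n₃ + 4r + n₂ r)`")] -/
theorem clusterSupp_subset_siteBall {r n₂ : ℕ} {x : Fin m} {Q : Finset (Fin m → ℤ)} (hQ : IsClusterAround r x Q) (hcard : Q.card ≤ n₂) :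
    clusterSupp Q ⊆ siteBall x (clusterRad r n₂) := by
  rintro y ⟨k, hk, hy⟩
  rw [mem_siteBall]
  by_contra h
  exact hy (hQ.2.2.2 k hk y (lt_of_le_of_lt (clusterRad_mono r hcard) (not_le.1 h)))

/-! ### The smooth step -/

/-- **The smooth step down**: `1` on `(-∞, a]`, `0` on `[b, ∞)`, smooth and antitone (`a < b`).
[cite: DeRoeckHuveneers2015, §4.2 (the smoothing in the convolution definition of `θ_{x,δ,n₂}`; here of the block conditions)] -/
def stepDown (a b s : ℝ) : ℝ := 1 - Real.smoothTransition ((s - a) / (b - a))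

/-- `0 ≤ stepDown ≤ 1`. [folklore] -/
theorem stepDown_nonneg (a b s : ℝ) : 0 ≤ stepDown a b s := by unfold stepDown; linarith [Real.smoothTransition.le_one ((s - a) / (b - a))]

/-- `stepDown ≤ 1`. [folklore] -/
theorem stepDown_le_one (a b s : ℝ) : stepDown a b s ≤ 1 := by unfold stepDown; linarith [Real.smoothTransition.nonneg ((s - a) / (b - a))]

/-- `stepDown = 1` exactly below `a`. [folklore] -/
theorem stepDown_eq_one_iff {a b s : ℝ} (hab : a < b) : stepDown a b s = 1 ↔ s ≤ a := by
  unfold stepDown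
  rw [sub_eq_self, Real.smoothTransition.zero_iff_nonpos, div_nonpos_iff]
  constructor
  · rintro (⟨h1, h2⟩ | ⟨h1, h2⟩) <;> linarith
  · intro h; right; exact ⟨by linarith, by linarith⟩

/-- `stepDown > 0` exactly below `b`. [folklore] -/
theorem stepDown_pos_iff {a b s : ℝ} (hab : a < b) : 0 < stepDown a b s ↔ s < b := by
  unfold stepDown
  rw [sub_pos]
  constructor
  · intro h
    by_contra hs
    have : 1 ≤ (s - a) / (b - a) := by rw [le_div_iff₀ (by linarith)]; linarith
    have := Real.smoothTransition.one_of_one_le this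
    linarith
  · intro h
    exact Real.smoothTransition.lt_one_of_lt_one (by rw [div_lt_one (by linarith)]; linarith)

/-- `stepDown = 0` above `b`. [folklore] -/
theorem stepDown_eq_zero {a b s : ℝ} (hab : a < b) (h : b ≤ s) : stepDown a b s = 0 := by
  have := (stepDown_pos_iff hab (s := s)).not.2 (not_lt.2 h)
  have h0 := stepDown_nonneg a b s
  push Not at this
  linarith

/-- `stepDown` is smooth. [folklore] -/
theorem contDiff_stepDown (a b : ℝ) : ContDiff ℝ ∞ (stepDown a b) := by
  unfold stepDown
  exact contDiff_const.sub (Real.smoothTransition.contDiff.comp ((contDiff_id.sub contDiff_const).div_const _))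

/-- For squares of nonnegative quantities with squared thresholds the step reads off the quantity:
`stepDown ((cδ)²) (((c+1)δ)²) (q²) = 1 ↔ q ≤ cδ`. [folklore] -/
theorem stepDown_sq_eq_one_iff {c δ q : ℝ} (hc : 0 ≤ c) (hδ : 0 < δ) (hq : 0 ≤ q) :
    stepDown ((c * δ) ^ 2) (((c + 1) * δ) ^ 2) (q ^ 2) = 1 ↔ q ≤ c * δ := by
  have hab : (c * δ) ^ 2 < ((c + 1) * δ) ^ 2 := pow_lt_pow_left₀ (by nlinarith) (by positivity) two_ne_zero
  rw [stepDown_eq_one_iff hab]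
  exact pow_le_pow_iff_left₀ hq (by positivity) two_ne_zero

/-- `stepDown ((cδ)²) (((c+1)δ)²) (q²) > 0 ↔ q < (c+1)δ`. [folklore] -/
theorem stepDown_sq_pos_iff {c δ q : ℝ} (hc : 0 ≤ c) (hδ : 0 < δ) (hq : 0 ≤ q) :
    0 < stepDown ((c * δ) ^ 2) (((c + 1) * δ) ^ 2) (q ^ 2) ↔ q < (c + 1) * δ := by
  have hab : (c * δ) ^ 2 < ((c + 1) * δ) ^ 2 := pow_lt_pow_left₀ (by nlinarith) (by positivity) two_ne_zero
  rw [stepDown_pos_iff hab]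
  exact pow_lt_pow_iff_left₀ hq (by positivity) two_ne_zero

/-! ### The smooth block indicator `ψ_Q` and the cut-off `θ_x` -/

variable (r : ℕ) (L : ℝ)

/-- **The smooth block indicator `ψ_Q`**: the product of the smooth steps of the main condition
(`d_Q` against `L^pδ`, `(L^p+1)δ`) and of every sub-family condition (`e_{Q,Q'}` against
`(L^p - L^{p'})δ`, `(L^p - L^{p'} + 1)δ`). [cite: DeRoeckHuveneers2015, §4.2 (definition of `B_δ(k_1,…,k_p)` and of `θ_{x,δ,n₂}`)] -/
def psiQ (Q : Finset (Fin m → ℤ)) (δ : ℝ) (ξ : Euc m) : ℝ :=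
  stepDown ((L ^ Q.card * δ) ^ 2) (((L ^ Q.card + 1) * δ) ^ 2) (dQ Q ξ ^ 2) *
    ∏ Q' ∈ subFamilies r Q, stepDown (((L ^ Q.card - L ^ Q'.card) * δ) ^ 2) (((L ^ Q.card - L ^ Q'.card + 1) * δ) ^ 2) (eQ Q Q' ξ ^ 2)

/-- **The cut-off `θ_x`** (on Euclidean momenta): `∏_{Q ∈ clusters} (1 - ψ_Q)`. [cite: DeRoeckHuveneers2015, §4.2 (definition of `θ_{x,δ,n₂}`, "a smooth indicator function of the complement of `R_{δ,n₂}(x)`")] -/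
def thetaX (n₂ : ℕ) (x : Fin m) (δ : ℝ) (ξ : Euc m) : ℝ := ∏ Q ∈ clusters r n₂ x, (1 - psiQ r L Q δ ξ)

/-- The cut-off as a family on `ℝ^m`. [cite: DeRoeckHuveneers2015, §4.2 (definition of `θ_{x,δ,n₂}`)] -/
def thetaW (n₂ : ℕ) (x : Fin m) (δ : ℝ) (w : Fin m → ℝ) : ℝ := thetaX r L n₂ x δ (wvec w)

variable {r L}

/-- `0 ≤ ψ_Q ≤ 1`. [folklore] -/
theorem psiQ_nonneg (Q : Finset (Fin m → ℤ)) (δ : ℝ) (ξ : Euc m) : 0 ≤ psiQ r L Q δ ξ :=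
  mul_nonneg (stepDown_nonneg _ _ _) (Finset.prod_nonneg fun _ _ => stepDown_nonneg _ _ _)

/-- `ψ_Q ≤ 1`. [folklore] -/
theorem psiQ_le_one (Q : Finset (Fin m → ℤ)) (δ : ℝ) (ξ : Euc m) : psiQ r L Q δ ξ ≤ 1 :=
  mul_le_one₀ (stepDown_le_one _ _ _) (Finset.prod_nonneg fun _ _ => stepDown_nonneg _ _ _)
    (Finset.prod_le_one (fun _ _ => stepDown_nonneg _ _ _) fun _ _ => stepDown_le_one _ _ _)

/-- `0 ≤ θ_x`. [cite: DeRoeckHuveneers2015, §4.2 ("a smooth indicator function")] -/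
theorem thetaX_nonneg (n₂ : ℕ) (x : Fin m) (δ : ℝ) (ξ : Euc m) : 0 ≤ thetaX r L n₂ x δ ξ :=
  Finset.prod_nonneg fun Q _ => by linarith [psiQ_le_one (r := r) (L := L) Q δ ξ]

/-- `θ_x ≤ 1`. [cite: DeRoeckHuveneers2015, §4.2 ("a smooth indicator function")] -/
theorem thetaX_le_one (n₂ : ℕ) (x : Fin m) (δ : ℝ) (ξ : Euc m) : thetaX r L n₂ x δ ξ ≤ 1 :=
  Finset.prod_le_one (fun Q _ => by linarith [psiQ_le_one (r := r) (L := L) Q δ ξ]) fun Q _ => by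
    linarith [psiQ_nonneg (r := r) (L := L) Q δ ξ]

/-- Exponent bookkeeping: sub-families are not larger. [folklore] -/
theorem pow_sub_nonneg {L : ℝ} (hL : 1 ≤ L) {Q Q' : Finset (Fin m → ℤ)} (hQ : IsLI Q) (hQ' : Q' ∈ subFamilies r Q) :
    0 ≤ L ^ Q.card - L ^ Q'.card := by
  obtain ⟨-, -, hli, hle⟩ := mem_subFamilies.1 hQ'
  exact sub_nonneg.2 (pow_le_pow_right₀ hL (card_le_of_isLI_of_le hQ hli hle))

/-- In `[0,1]`, `a b = 1 ↔ a = 1 ∧ b = 1`. [folklore] -/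
theorem mul_eq_one_iff_of_unit {a b : ℝ} (ha0 : 0 ≤ a) (ha1 : a ≤ 1) (hb0 : 0 ≤ b) (hb1 : b ≤ 1) : a * b = 1 ↔ a = 1 ∧ b = 1 := by
  constructor
  · intro h; constructor <;> nlinarith
  · rintro ⟨rfl, rfl⟩; norm_num

/-- In `[0,1]`, a finite product is `1` iff all factors are. [folklore] -/
theorem prod_eq_one_iff_of_unit {ι : Type*} (s : Finset ι) {f : ι → ℝ} (h0 : ∀ i ∈ s, 0 ≤ f i) (h1 : ∀ i ∈ s, f i ≤ 1) :
    ∏ i ∈ s, f i = 1 ↔ ∀ i ∈ s, f i = 1 := by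
  classical
  induction s using Finset.induction_on with
  | empty => simp
  | insert a s ha ih =>
    rw [Finset.prod_insert ha, mul_eq_one_iff_of_unit (h0 a (Finset.mem_insert_self a s)) (h1 a (Finset.mem_insert_self a s))
      (Finset.prod_nonneg fun i hi => h0 i (Finset.mem_insert_of_mem hi))
      (Finset.prod_le_one (fun i hi => h0 i (Finset.mem_insert_of_mem hi)) fun i hi => h1 i (Finset.mem_insert_of_mem hi)),
      ih (fun i hi => h0 i (Finset.mem_insert_of_mem hi)) (fun i hi => h1 i (Finset.mem_insert_of_mem hi)), Finset.forall_mem_insert]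

/-- For nonnegative factors, a finite product is positive iff all factors are. [folklore] -/
theorem prod_pos_iff_of_nonneg {ι : Type*} (s : Finset ι) {f : ι → ℝ} (h0 : ∀ i ∈ s, 0 ≤ f i) :
    0 < ∏ i ∈ s, f i ↔ ∀ i ∈ s, 0 < f i := by
  constructor
  · intro h i hi
    rcases (h0 i hi).lt_or_eq with h' | h'
    · exact h'
    · exfalso
      have : ∏ i ∈ s, f i = 0 := Finset.prod_eq_zero hi h'.symm
      linarith
  · exact fun h => Finset.prod_pos h

/-- **`ψ_Q = 1` exactly on the core block `B_δ(Q)`.** [cite: DeRoeckHuveneers2015, §4.2 (definition of `B_δ(k_1,…,k_p)`)] -/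
theorem psiQ_eq_one_iff {L δ : ℝ} (hL : 1 ≤ L) (hδ : 0 < δ) {Q : Finset (Fin m → ℤ)} (hQ : IsLI Q) (ξ : Euc m) :
    psiQ r L Q δ ξ = 1 ↔ InCore r L δ Q ξ := by
  have hmain0 : 0 ≤ L ^ Q.card := by positivity
  unfold psiQ InCore
  rw [mul_eq_one_iff_of_unit (stepDown_nonneg _ _ _) (stepDown_le_one _ _ _) (Finset.prod_nonneg fun _ _ => stepDown_nonneg _ _ _)
    (Finset.prod_le_one (fun _ _ => stepDown_nonneg _ _ _) fun _ _ => stepDown_le_one _ _ _),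
    prod_eq_one_iff_of_unit _ (fun _ _ => stepDown_nonneg _ _ _) (fun _ _ => stepDown_le_one _ _ _),
    stepDown_sq_eq_one_iff hmain0 hδ (dQ_nonneg Q ξ)]
  refine and_congr Iff.rfl (forall₂_congr fun Q' hQ' => ?_)
  exact stepDown_sq_eq_one_iff (pow_sub_nonneg hL hQ hQ') hδ (eQ_nonneg Q Q' ξ)

/-- **`ψ_Q > 0` exactly on the enlarged block.** [cite: DeRoeckHuveneers2015, §4.2] -/
theorem psiQ_pos_iff {L δ : ℝ} (hL : 1 ≤ L) (hδ : 0 < δ) {Q : Finset (Fin m → ℤ)} (hQ : IsLI Q) (ξ : Euc m) :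
    0 < psiQ r L Q δ ξ ↔ InEnlarged r L δ Q ξ := by
  have hmain0 : 0 ≤ L ^ Q.card := by positivity
  -- a product of nonnegative reals is positive iff all factors are
  have hiff : ∀ {a b : ℝ}, 0 ≤ a → 0 ≤ b → (0 < a * b ↔ 0 < a ∧ 0 < b) := by
    intro a b ha hb
    constructor
    · intro h
      rcases ha.lt_or_eq with ha' | ha'
      · rcases hb.lt_or_eq with hb' | hb'
        · exact ⟨ha', hb'⟩
        · rw [← hb', mul_zero] at h; exact absurd h (lt_irrefl 0)
      · rw [← ha', zero_mul] at h; exact absurd h (lt_irrefl 0)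
    · rintro ⟨h1, h2⟩; exact mul_pos h1 h2
  unfold psiQ InEnlarged
  rw [hiff (stepDown_nonneg _ _ _) (Finset.prod_nonneg fun _ _ => stepDown_nonneg _ _ _),
    prod_pos_iff_of_nonneg _ (fun _ _ => stepDown_nonneg _ _ _), stepDown_sq_pos_iff hmain0 hδ (dQ_nonneg Q ξ)]
  refine and_congr Iff.rfl (forall₂_congr fun Q' hQ' => ?_)
  exact stepDown_sq_pos_iff (pow_sub_nonneg hL hQ hQ') hδ (eQ_nonneg Q Q' ξ)

/-! ### Properties of `θ_x`: the first item of Prop. 2, the near-resonance behind `θ_x < 1`, locality -/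

section Props

variable {r n₂ : ℕ} {L δ : ℝ} {x : Fin m}

/-- Each factor of `θ_x` is in `[0, 1]`. [folklore] -/
theorem thetaX_factor_mem (Q : Finset (Fin m → ℤ)) (δ : ℝ) (ξ : Euc m) : 0 ≤ 1 - psiQ r L Q δ ξ ∧ 1 - psiQ r L Q δ ξ ≤ 1 :=
  ⟨by linarith [psiQ_le_one (r := r) (L := L) Q δ ξ], by linarith [psiQ_nonneg (r := r) (L := L) Q δ ξ]⟩

/-- `θ_x > 0` forces `ψ_Q < 1` for every cluster `Q`. [folklore] -/
theorem psiQ_lt_one_of_thetaX_pos {ξ : Euc m} (h : 0 < thetaX r L n₂ x δ ξ) {Q : Finset (Fin m → ℤ)} (hQ : Q ∈ clusters r n₂ x) :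
    psiQ r L Q δ ξ < 1 := by
  have := (prod_pos_iff_of_nonneg (clusters r n₂ x) (f := fun Q => 1 - psiQ r L Q δ ξ) (fun Q _ => (thetaX_factor_mem Q δ ξ).1)).1 h Q hQ
  linarith

/-- `θ_x < 1` forces `ψ_Q > 0` for some cluster `Q`. [folklore] -/
theorem exists_psiQ_pos_of_thetaX_lt_one {ξ : Euc m} (h : thetaX r L n₂ x δ ξ < 1) :
    ∃ Q ∈ clusters r n₂ x, 0 < psiQ r L Q δ ξ := by
  by_contra hc
  push Not at hc
  have : thetaX r L n₂ x δ ξ = 1 := by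
    unfold thetaX
    exact Finset.prod_eq_one fun Q hQ => by linarith [hc Q hQ, psiQ_nonneg (r := r) (L := L) Q δ ξ]
  linarith

/-- Sub-families of a singleton `{k}` span the same line. [folklore] -/
theorem modeSpan_eq_of_mem_subFamilies_singleton {k : Fin m → ℤ} (hk : k ≠ 0) {Q' : Finset (Fin m → ℤ)}
    (hQ' : Q' ∈ subFamilies r {k}) : modeSpan Q' = modeSpan {k} := by
  obtain ⟨-, hne, hli, hle⟩ := mem_subFamilies.1 hQ'
  have hli1 : IsLI ({k} : Finset (Fin m → ℤ)) := isLI_singleton hk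
  have hcard : Q'.card ≤ 1 := by simpa using card_le_of_isLI_of_le hli1 hli hle
  have hcard1 : Q'.card = 1 := le_antisymm hcard (Finset.card_pos.2 hne)
  exact modeSpan_eq_of_card_eq hli1 hli hle (by rw [hcard1, Finset.card_singleton])

/-- **Proposition 2, first item**: if `θ_x(ω) > 0` then every `k ∈ K_r(B(x,4r))` is non-resonant, `|k·ω| > Lδ ≥ 2δ`
(`L ≥ 3`, `n₂ ≥ 1`). [cite: DeRoeckHuveneers2015, §4.2 Prop. 2, first item, and its proof in §4.3 ("`|ω·k| ≥ Lδ - 2δr² > 2δ` if `L` is large enough")] -/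
theorem nonres_of_thetaX_pos (hn₂ : 1 ≤ n₂) (hL : 3 ≤ L) (hδ : 0 < δ) {w : Fin m → ℝ} (h : 0 < thetaW r L n₂ x δ w)
    {k : Fin m → ℤ} (hk : IsKMode r k) (hn : ModeNear x (4 * r) k) : 2 * δ < |modeFreq k w| := by
  have hL1 : 1 ≤ L := by linarith
  have hQ : ({k} : Finset (Fin m → ℤ)) ∈ clusters r n₂ x := mem_clusters.2 ⟨isClusterAround_singleton hk hn, by simpa using hn₂⟩
  have hlt := psiQ_lt_one_of_thetaX_pos h hQ
  have hnot : ¬ InCore r L δ {k} (wvec w) := fun hc => by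
    have := (psiQ_eq_one_iff hL1 hδ (isLI_singleton hk.1) (wvec w)).2 hc
    linarith
  unfold InCore at hnot
  rw [not_and_or] at hnot
  rcases hnot with h1 | h2
  · rw [not_le, Finset.card_singleton, pow_one] at h1
    have hd := dQ_singleton_le hk.1 (wvec w)
    rw [inner_kvec_wvec] at hd
    nlinarith
  · exfalso; apply h2
    intro Q' hQ'
    rw [eQ_eq_zero_of_eq (modeSpan_eq_of_mem_subFamilies_singleton hk.1 hQ')]
    exact mul_nonneg (pow_sub_nonneg hL1 (isLI_singleton hk.1) hQ') hδ.le

/-- **The near-resonance behind `θ_x < 1`**: if `θ_x(ω) < 1` then some `k ∈ K_r(B(x, 4r + 2r(n₂-1)))` has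
`|k·ω| ≤ L^{n₂+1}δ` (`L ≥ 2rm`). [cite: DeRoeckHuveneers2015, §5.5 proof of Lemma 4, first claim ("If `θ_x(ω) < 1`, there exists … a cluster `{k_1, …, k_p}` around `x`, with `p ≤ n₂` … therefore `|ω·k_1| ≤ |k_1|₂ L^p δ + r²δ ≤ L^{n₂+1}δ`")] -/
theorem nearRes_of_thetaX_lt_one (hL : 1 ≤ L) (hLr : 2 * (r : ℝ) * m ≤ L) (hδ : 0 < δ) {w : Fin m → ℝ}
    (h : thetaW r L n₂ x δ w < 1) :
    ∃ k, IsKMode r k ∧ ModeNear x (clusterRad r n₂) k ∧ |modeFreq k w| ≤ L ^ (n₂ + 1) * δ := by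
  obtain ⟨Q, hQ, hpos⟩ := exists_psiQ_pos_of_thetaX_lt_one h
  obtain ⟨hcl, hcard⟩ := mem_clusters.1 hQ
  obtain ⟨hne, hK, hli, hsupp⟩ := hcl
  obtain ⟨k, hk⟩ := hne
  have henl := (psiQ_pos_iff hL hδ hli (wvec w)).1 hpos
  refine ⟨k, hK k hk, fun y hy => hsupp k hk y (lt_of_le_of_lt (clusterRad_mono r hcard) hy), ?_⟩
  have h1 := abs_inner_kvec_le_of_mem hk (wvec w)
  rw [inner_kvec_wvec] at h1
  have h2 : dQ Q (wvec w) < (L ^ Q.card + 1) * δ := henl.1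
  have hkn : ‖kvec k‖ ≤ r * m := norm_kvec_le (hK k hk).2.1
  have hpow : L ^ Q.card ≤ L ^ n₂ := pow_le_pow_right₀ hL hcard
  have hpow1 : 1 ≤ L ^ n₂ := one_le_pow₀ hL
  have hdn : 0 ≤ dQ Q (wvec w) := dQ_nonneg _ _
  calc |modeFreq k w| ≤ ‖kvec k‖ * ‖proj Q (wvec w)‖ := h1
    _ = ‖kvec k‖ * dQ Q (wvec w) := rfl
    _ ≤ (r * m) * ((L ^ n₂ + 1) * δ) := mul_le_mul hkn (by nlinarith) hdn (by positivity)
    _ ≤ (r * m) * (2 * L ^ n₂ * δ) := by gcongr; linarith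
    _ = (2 * r * m) * L ^ n₂ * δ := by ring
    _ ≤ L * L ^ n₂ * δ := by gcongr
    _ = L ^ (n₂ + 1) * δ := by rw [pow_succ]; ring

/-- **Locality of `θ_x`** — it depends on `ω` only through `B(x, 4r + 2r(n₂-1))`.
[cite: DeRoeckHuveneers2015, §5.3 ("the functions `ϑ_{a,x}` … only depend on variables indexed by `z` with `z ≥ a - (n₃ + 4r + n₂ r)`")] -/
theorem thetaW_eq_of_eqOn {w w' : Fin m → ℝ} (h : ∀ y ∈ siteBall x (clusterRad r n₂), w y = w' y) (δ : ℝ) :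
    thetaW r L n₂ x δ w = thetaW r L n₂ x δ w' := by
  unfold thetaW thetaX
  refine Finset.prod_congr rfl fun Q hQ => ?_
  obtain ⟨hcl, hcard⟩ := mem_clusters.1 hQ
  have hS : ∀ y ∈ clusterSupp Q, w y = w' y := fun y hy => h y (clusterSupp_subset_siteBall hcl hcard hy)
  have hP : proj Q (wvec w) = proj Q (wvec w') := proj_wvec_eq_of_eqOn hS
  have hP' : ∀ Q' ∈ subFamilies r Q, proj Q' (wvec w) = proj Q' (wvec w') := fun Q' hQ' =>
    proj_wvec_eq_of_eqOn fun y hy => hS y (clusterSupp_subset_of_le (mem_subFamilies.1 hQ').2.2.2 hy)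
  unfold psiQ dQ eQ
  rw [hP]
  have hprod : ∏ Q' ∈ subFamilies r Q, stepDown (((L ^ Q.card - L ^ Q'.card) * δ) ^ 2) (((L ^ Q.card - L ^ Q'.card + 1) * δ) ^ 2)
        (‖proj Q (wvec w') - proj Q' (wvec w)‖ ^ 2) =
      ∏ Q' ∈ subFamilies r Q, stepDown (((L ^ Q.card - L ^ Q'.card) * δ) ^ 2) (((L ^ Q.card - L ^ Q'.card + 1) * δ) ^ 2)
        (‖proj Q (wvec w') - proj Q' (wvec w')‖ ^ 2) :=
    Finset.prod_congr rfl fun Q' hQ' => by rw [hP' Q' hQ']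
  rw [hprod]

/-- As a `DependsOn` statement. [cite: DeRoeckHuveneers2015, §5.3 ("the functions `ϑ_{a,x}` … only depend on variables indexed by `z` with `z ≥ a - (n₃ + 4r + n₂ r)`")] -/
theorem dependsOn_thetaW (δ : ℝ) : DependsOn (thetaW r L n₂ x δ) (siteBall x (clusterRad r n₂)) :=
  fun _ _ h => thetaW_eq_of_eqOn h δ

end Props

end Literature.Barriers.AtomisticToContinuum.HeatConduction.RotorChain

end
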